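import Summits.HodgeConjecture.HodgeConjecture.Theses.TropicalWeilObstruction
import Summits.HodgeConjecture.HodgeConjecture.Theorems.TropicalWeilObstructionTropicalWeilVanishingClassPositivityFrameDensity
import Summits.HodgeConjecture.HodgeConjecture.Theorems.TropicalWeilObstructionTropicalWeilVanishingClassPositivityRotation
import HarnessLib

/-!
# Route `TropicalWeilObstruction` (Kontsevich's tropical test — NEGATION SINK, exploration, no summit claim):
# class positivity is exhausted by the calibration cone at every Weil period (V) — the whole cone, all phases

Negation-sink bookkeeping of the cell `pub-hodge-tropical` (seat tropical-2 gen 5). Parts I–III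
(`…ClassPositivity{Transport,AllPeriods,FrameDensity}`) transported tropical-1's `Q = 1` certificate (κ = 8, p337681) to the boundary
RAY `8 θ₄(Q) + Re w(Q)` of the calibration cone `64(q₁² + q₂²) ≤ q₀²` (p332805) at every Weil period; Part IV (`…ClassPositivityRotation`)
supplied the phase rotations `g = a·1 + b·J` (orthogonal, commuting with `J` and every `J`-commuting `Q`, `M_g = (a+ib)·1`). This part
turns the ray around the whole boundary circle and fills the cone with the theta class:

* `cone_boundary_eq_sum_realFrameSquares` — for EVERY `Q ≻ 0` with `QJ = JQ` and every unit
  `u = c + is`: `24 · (8 θ₄(Q) + c Re w(Q) + s Im w(Q)) = Σ_{j<206} n_j p_{F_j} ⊗ p_{F_j}` with real frames `F_j = g √Q L_j`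
  (`(a+ib)⁸ = c − is`): EVERY boundary point of the cone at every Weil period is a positive combination of real frame squares;
* `thetaClass_eq_sum_realFrameSquares` — `24 θ₄(Q) = Σ_I p_{F_I} ⊗ p_{F_I}` over the `4`-words `I` (`F_I = (√Q)ᵀ[·, I]`): the axis too;
* `nonneg_on_calibrationCone_of_nonneg_frameSquares` — hence every linear functional that is `≥ 0` on the squares of SATURATED INTEGER
  frames (every class-level necessary condition for effectivity, `Kappa.nonneg_cyc_of_nonneg_frameSquares`) is `≥ 0` on
  `q₀ θ₄(Q) + q₁ Re w(Q) + q₂ Im w(Q)` for EVERY `(q₀,q₁,q₂)` in the calibration cone and EVERY Weil period `Q`: the calibration cone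
  (effective classes ⊆ it, p332805) lies inside the closed cone of class positivity at every period — the two coincide on K3's
  `3`-space as far as any class-level argument can tell. K1 asserts that effective classes at very general `Q` nevertheless stay on the
  axis; only the balanced TYPE can show that.

HONEST STATUS. Linear algebra on landed files; decides nothing about K1 or about the Hodge conjecture. No definition, no named fact,
no sorry. References: [Zharkov2020TropicalWeil] I. Zharkov, arXiv:2002.02347, §2 (pp. 2–4); [MikhalkinZharkov2014Eigenwave] G. Mikhalkin,
I. Zharkov, LN UMI 15 (2014), Prop. 4.3; [BlekhermanSmithVelasco2016] G. Blekherman, G. G. Smith, M. Velasco, JAMS 29 (2016), Thm. 1.1.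
-/

set_option linter.dupNamespace false

noncomputable section

open scoped BigOperators
open Matrix
open Literature.AlgebraicGeometry.Tropical
open Summit.HodgeConjecture.HodgeConjecture.Theorems.TropicalHodgeBound

namespace Summit.HodgeConjecture.HodgeConjecture.Theorems.TropicalWeilVanishing.Kappa

/-! ## §0 Display-only notation (verbatim bodies of Parts I–III; nothing is defined) -/

/-- `P = [1 | i·1]`. -/
local notation3 (prettyPrint := false) "𝐏⟦" n "⟧" =>
  (Matrix.of fun (k : Fin n) (a : Fin (2 * n)) =>
    (if (a : ℕ) = (k : ℕ) then (1 : ℂ) else 0) + (if (a : ℕ) = (k : ℕ) + n then Complex.I else 0))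

/-- The skeleton's `thetaClass n Q`. -/
local notation3 (prettyPrint := false) "θ⟦" n "⟧" Q:max =>
  (fun S S' : Fin n → Fin (2 * n) => Matrix.det (Matrix.submatrix Q S S'))

/-- The skeleton's `omegaFrame n` (`Ω = Pᴴ`). -/
local notation3 (prettyPrint := false) "Ω⟦" n "⟧" =>
  (Matrix.of fun (a : Fin (2 * n)) (b : Fin n) =>
    (if (a : ℕ) = (b : ℕ) then (1 : ℂ) else 0) - (if (a : ℕ) = (b : ℕ) + n then Complex.I else 0))

/-- The skeleton's `weilClassC n Q`. -/
local notation3 (prettyPrint := false) "wC⟦" n "⟧" Q:max =>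
  (fun S S' : Fin n → Fin (2 * n) =>
    Matrix.det (Matrix.submatrix (Matrix.map Q ((↑) : ℝ → ℂ) * Ω⟦n⟧) S id) *
      Matrix.det (Matrix.submatrix (Ω⟦n⟧) S' id))

/-- The skeleton's `weilClassRe n Q`. -/
local notation3 (prettyPrint := false) "wRe⟦" n "⟧" Q:max =>
  (fun S S' : Fin n → Fin (2 * n) => Complex.re ((wC⟦n⟧ Q) S S'))

/-- The skeleton's `weilClassIm n Q`. -/
local notation3 (prettyPrint := false) "wIm⟦" n "⟧" Q:max =>
  (fun S S' : Fin n → Fin (2 * n) => Complex.im ((wC⟦n⟧ Q) S S'))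

/-- `M_Q := ½ · P Q Pᴴ`. -/
local notation3 (prettyPrint := false) "𝐌⟦" n "⟧" Q:max =>
  ((2 : ℂ)⁻¹ • (𝐏⟦n⟧ * Matrix.map Q ((↑) : ℝ → ℂ) * (𝐏⟦n⟧)ᴴ))

/-- The square `p_F ⊗ p_F` of the Plücker vector of a real `8 × 4` matrix `F`. -/
local notation3 (prettyPrint := false) "sq⟦" F "⟧" =>
  (fun S S' : Fin 4 → Fin (2 * 4) =>
    Matrix.det (Matrix.submatrix F S id) * Matrix.det (Matrix.submatrix F S' id))

/-! ## §3 The whole boundary circle, and the axis -/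

/-- **Every boundary point of the calibration cone at every Weil period is a positive combination of real frame squares.** For
`Q ≻ 0` with `QJ = JQ` and every `c, s ∈ ℝ` with `c² + s² = 1` there are positive integers `n_j` and real `8 × 4` frames `F_j`
(`j < 206`; `F_j = g·√Q·L_j` with `g = a·1 + b·J` a rotation, `L_j` tropical-1's saturated integer frames) with
`24 · (8 · θ₄(Q) + c · Re w(Q) + s · Im w(Q)) = Σ_j n_j · p_{F_j} ⊗ p_{F_j}`. (`64(c² + s²) = 8²`: the boundary circle of the cone of
p332805 at height `q₀ = 8`.) [cite: Zharkov2020TropicalWeil, §2] [cite: BlekhermanSmithVelasco2016, Thm. 1.1] -/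
theorem cone_boundary_eq_sum_realFrameSquares (Q : Matrix (Fin (2 * 4)) (Fin (2 * 4)) ℝ) (hQ : Q.PosDef)
    (hJ : Q * weilJ 4 = weilJ 4 * Q) (c s : ℝ) (hcs : c ^ 2 + s ^ 2 = 1) :
    ∃ (w : Fin 206 → ℕ) (F : Fin 206 → Matrix (Fin (2 * 4)) (Fin 4) ℝ), (∀ j, 0 < w j) ∧
      (24 : ℝ) • ((8 : ℝ) • θ⟦4⟧ Q + c • wRe⟦4⟧ Q + s • wIm⟦4⟧ Q) = ∑ j, ((w j : ℕ) : ℝ) • sq⟦F j⟧ := by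
  obtain ⟨w, L, hw, -, hid⟩ := boundaryRay_eq_sum_frameSquares
  obtain ⟨h, -, hhQ, hhJ, hT⟩ := exists_sqrt_commuting_weilJ Q hQ hJ
  -- an eighth root `z = a + ib` of `c - is`; `|z| = 1`
  obtain ⟨z, hz⟩ := IsAlgClosed.exists_pow_nat_eq ((c : ℂ) - (s : ℂ) * Complex.I) (by norm_num : 0 < 8)
  have hw1 : Complex.normSq ((c : ℂ) - (s : ℂ) * Complex.I) = 1 := by
    rw [Complex.normSq_apply]
    simp only [Complex.sub_re, Complex.ofReal_re, Complex.mul_re, Complex.I_re, Complex.ofReal_im, Complex.I_im,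
      Complex.sub_im, Complex.mul_im]
    nlinarith [hcs]
  have hzn : ‖z‖ = 1 := by
    have h1 : ‖z‖ ^ 8 = 1 := by
      rw [← norm_pow, hz]
      have h2 : ‖(c : ℂ) - (s : ℂ) * Complex.I‖ ^ 2 = 1 := by rw [Complex.sq_norm, hw1]
      nlinarith [norm_nonneg ((c : ℂ) - (s : ℂ) * Complex.I), h2]
    exact (pow_eq_one_iff_of_nonneg (norm_nonneg z) (by norm_num)).mp h1
  obtain ⟨a, ha⟩ : ∃ a : ℝ, a = z.re := ⟨_, rfl⟩
  obtain ⟨b, hb⟩ : ∃ b : ℝ, b = z.im := ⟨_, rfl⟩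
  have hab : a ^ 2 + b ^ 2 = 1 := by
    have h2 : Complex.normSq z = 1 := by rw [← Complex.sq_norm, hzn]; norm_num
    rw [Complex.normSq_apply] at h2
    rw [ha, hb]; nlinarith [h2]
  have hz' : ((a : ℂ) + (b : ℂ) * Complex.I) = z := by rw [ha, hb]; exact Complex.re_add_im z
  -- the rotation `g` and the frame map `k = g √Q`
  obtain ⟨g, hg⟩ : ∃ g : Matrix (Fin (2 * 4)) (Fin (2 * 4)) ℝ,
      g = a • (1 : Matrix (Fin (2 * 4)) (Fin (2 * 4)) ℝ) + b • weilJ 4 := ⟨_, rfl⟩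
  have gJ : g * weilJ 4 = weilJ 4 * g := by rw [hg]; exact rot_mul_weilJ a b
  have gQ : g * Q = Q * g := by rw [hg]; exact rot_mul_comm a b Q hJ
  have ggT : g * gᵀ = 1 := by rw [hg]; exact rot_mul_transpose a b hab
  have hMg : 𝐌⟦4⟧ g = z • (1 : Matrix (Fin 4) (Fin 4) ℂ) := by rw [hg, M_rot, hz']
  obtain ⟨k, hk⟩ : ∃ k : Matrix (Fin (2 * 4)) (Fin (2 * 4)) ℝ, k = g * h := ⟨_, rfl⟩
  have kJ : k * weilJ 4 = weilJ 4 * k := by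
    rw [hk, Matrix.mul_assoc, hhJ, ← Matrix.mul_assoc, gJ, Matrix.mul_assoc]
  have kkT : k * kᵀ = Q := by
    calc k * kᵀ = g * h * (hᵀ * gᵀ) := by rw [hk, Matrix.transpose_mul]
      _ = g * (h * h) * gᵀ := by rw [hT]; simp only [Matrix.mul_assoc]
      _ = (g * Q) * gᵀ := by rw [hhQ]
      _ = (Q * g) * gᵀ := by rw [gQ]
      _ = Q * (g * gᵀ) := Matrix.mul_assoc _ _ _
      _ = Q := by rw [ggT, Matrix.mul_one]
  have hMk : (𝐌⟦4⟧ k).det * (𝐌⟦4⟧ k).det = ((c : ℂ) - (s : ℂ) * Complex.I) * (𝐌⟦4⟧ Q).det := by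
    have e1 : 𝐌⟦4⟧ k = 𝐌⟦4⟧ g * 𝐌⟦4⟧ h := by rw [hk]; exact M_mul g h gJ hhJ
    have e2 : 𝐌⟦4⟧ h * 𝐌⟦4⟧ h = 𝐌⟦4⟧ Q := by rw [← hhQ]; exact M_mul_M_eq h hhJ
    rw [e1, hMg, Matrix.det_mul, Matrix.det_smul, Matrix.det_one, Fintype.card_fin, mul_one]
    calc z ^ 4 * (𝐌⟦4⟧ h).det * (z ^ 4 * (𝐌⟦4⟧ h).det) = z ^ 8 * ((𝐌⟦4⟧ h).det * (𝐌⟦4⟧ h).det) := by ring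
      _ = ((c : ℂ) - (s : ℂ) * Complex.I) * (𝐌⟦4⟧ Q).det := by rw [hz, ← Matrix.det_mul, e2]
  refine ⟨w, fun j => k * (L j).map ((↑) : ℤ → ℝ), hw, ?_⟩
  -- the `Q = 1` identity at a word pair
  have hid1 : ∀ I I' : Fin 4 → Fin (2 * 4),
      24 * (8 * ((1 : Matrix (Fin (2 * 4)) (Fin (2 * 4)) ℝ).submatrix I I').det +
          (wRe⟦4⟧ (1 : Matrix (Fin (2 * 4)) (Fin (2 * 4)) ℝ)) I I') =
        ∑ j, ((w j : ℕ) : ℝ) * (sq⟦(L j).map ((↑) : ℤ → ℝ)⟧ I I') := by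
    intro I I'
    have e := congrFun (congrFun hid I) I'
    simp only [Pi.smul_apply, Pi.add_apply, Finset.sum_apply, smul_eq_mul] at e
    rw [e]
    refine Finset.sum_congr rfl fun j _ => ?_
    rw [pluckerCoord, pluckerCoord, Int.cast_det, Int.cast_det]
    rfl
  -- push-forward of `Re w(1)` by `k` is `c Re w(Q) + s Im w(Q)`
  have h1J : (1 : Matrix (Fin (2 * 4)) (Fin (2 * 4)) ℝ) * weilJ 4 = weilJ 4 * 1 := by
    rw [Matrix.one_mul, Matrix.mul_one]
  have hwr : ∀ S S' : Fin 4 → Fin (2 * 4), ∑ I : Fin 4 → Fin (2 * 4), ∑ I' : Fin 4 → Fin (2 * 4),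
      (k.submatrix S I).det * (k.submatrix S' I').det * (wRe⟦4⟧ (1 : Matrix (Fin (2 * 4)) (Fin (2 * 4)) ℝ)) I I' =
        576 * (c * (wRe⟦4⟧ Q) S S' + s * (wIm⟦4⟧ Q) S S') := by
    intro S S'
    -- complex form
    have hC : ∑ I : Fin 4 → Fin (2 * 4), ∑ I' : Fin 4 → Fin (2 * 4),
        (((k.submatrix S I).det : ℝ) : ℂ) * (((k.submatrix S' I').det : ℝ) : ℂ) *
          (wC⟦4⟧ (1 : Matrix (Fin (2 * 4)) (Fin (2 * 4)) ℝ)) I I' =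
        (576 : ℂ) * (((c : ℂ) - (s : ℂ) * Complex.I) * (wC⟦4⟧ Q) S S') := by
      have hw1 : ∀ I I' : Fin 4 → Fin (2 * 4), (wC⟦4⟧ (1 : Matrix (Fin (2 * 4)) (Fin (2 * 4)) ℝ)) I I' =
          ((Ω⟦4⟧).submatrix I id).det * ((Ω⟦4⟧).submatrix I' id).det := by
        intro I I'
        rw [weilClassC_eq_det_mul 1 h1J I I', M_one, Matrix.det_one, one_mul]
      simp_rw [hw1]
      calc ∑ I : Fin 4 → Fin (2 * 4), ∑ I' : Fin 4 → Fin (2 * 4),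
            (((k.submatrix S I).det : ℝ) : ℂ) * (((k.submatrix S' I').det : ℝ) : ℂ) *
              (((Ω⟦4⟧).submatrix I id).det * ((Ω⟦4⟧).submatrix I' id).det)
          = (∑ I : Fin 4 → Fin (2 * 4), (((k.submatrix S I).det : ℝ) : ℂ) * ((Ω⟦4⟧).submatrix I id).det) *
              (∑ I' : Fin 4 → Fin (2 * 4), (((k.submatrix S' I').det : ℝ) : ℂ) * ((Ω⟦4⟧).submatrix I' id).det) := by
            rw [Finset.sum_mul_sum]
            refine Finset.sum_congr rfl fun I _ => Finset.sum_congr rfl fun I' _ => ?_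
            ring
        _ = (24 * ((𝐌⟦4⟧ k).det * ((Ω⟦4⟧).submatrix S id).det)) *
              (24 * ((𝐌⟦4⟧ k).det * ((Ω⟦4⟧).submatrix S' id).det)) := by
            rw [sum_det_submatrix_mul_omega k kJ S, sum_det_submatrix_mul_omega k kJ S']
        _ = (576 : ℂ) * (((𝐌⟦4⟧ k).det * (𝐌⟦4⟧ k).det) *
              (((Ω⟦4⟧).submatrix S id).det * ((Ω⟦4⟧).submatrix S' id).det)) := by ring
        _ = (576 : ℂ) * (((c : ℂ) - (s : ℂ) * Complex.I) * (wC⟦4⟧ Q) S S') := by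
            rw [hMk, weilClassC_eq_det_mul Q hJ S S']; ring
    have hre := congrArg Complex.re hC
    rw [Complex.re_sum] at hre
    simp_rw [Complex.re_sum] at hre
    have lhs : ∀ I I' : Fin 4 → Fin (2 * 4),
        ((((k.submatrix S I).det : ℝ) : ℂ) * (((k.submatrix S' I').det : ℝ) : ℂ) *
            (wC⟦4⟧ (1 : Matrix (Fin (2 * 4)) (Fin (2 * 4)) ℝ)) I I').re =
          (k.submatrix S I).det * (k.submatrix S' I').det *
            (wRe⟦4⟧ (1 : Matrix (Fin (2 * 4)) (Fin (2 * 4)) ℝ)) I I' := by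
      intro I I'
      rw [← Complex.ofReal_mul, Complex.re_ofReal_mul]
    simp_rw [lhs] at hre
    rw [hre]
    have e : ((576 : ℂ) * (((c : ℂ) - (s : ℂ) * Complex.I) * (wC⟦4⟧ Q) S S')).re =
        576 * (c * ((wC⟦4⟧ Q) S S').re + s * ((wC⟦4⟧ Q) S S').im) := by
      rw [show (576 : ℂ) = ((576 : ℝ) : ℂ) by norm_num, Complex.re_ofReal_mul, Complex.mul_re]
      simp only [Complex.sub_re, Complex.sub_im, Complex.ofReal_re, Complex.ofReal_im, Complex.mul_re,
        Complex.mul_im, Complex.I_re, Complex.I_im]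
      ring
    exact e
  funext S S'
  simp only [Pi.smul_apply, Pi.add_apply, Finset.sum_apply, smul_eq_mul]
  have key : ∑ I : Fin 4 → Fin (2 * 4), ∑ I' : Fin 4 → Fin (2 * 4),
      (k.submatrix S I).det * (k.submatrix S' I').det *
        (24 * (8 * ((1 : Matrix (Fin (2 * 4)) (Fin (2 * 4)) ℝ).submatrix I I').det +
          (wRe⟦4⟧ (1 : Matrix (Fin (2 * 4)) (Fin (2 * 4)) ℝ)) I I')) =
      ∑ I : Fin 4 → Fin (2 * 4), ∑ I' : Fin 4 → Fin (2 * 4),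
        (k.submatrix S I).det * (k.submatrix S' I').det *
          ∑ j, ((w j : ℕ) : ℝ) * (sq⟦(L j).map ((↑) : ℤ → ℝ)⟧ I I') := by
    simp_rw [hid1]
  have hLHS : ∑ I : Fin 4 → Fin (2 * 4), ∑ I' : Fin 4 → Fin (2 * 4),
      (k.submatrix S I).det * (k.submatrix S' I').det *
        (24 * (8 * ((1 : Matrix (Fin (2 * 4)) (Fin (2 * 4)) ℝ).submatrix I I').det +
          (wRe⟦4⟧ (1 : Matrix (Fin (2 * 4)) (Fin (2 * 4)) ℝ)) I I')) =
      576 * (24 * (8 * (Q.submatrix S S').det + (c * (wRe⟦4⟧ Q) S S' + s * (wIm⟦4⟧ Q) S S'))) := by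
    have hθ := pushforward_thetaClass_one' k S S'
    rw [kkT] at hθ
    have split : ∀ I : Fin 4 → Fin (2 * 4),
        ∑ I' : Fin 4 → Fin (2 * 4), (k.submatrix S I).det * (k.submatrix S' I').det *
            (24 * (8 * ((1 : Matrix (Fin (2 * 4)) (Fin (2 * 4)) ℝ).submatrix I I').det +
              (wRe⟦4⟧ (1 : Matrix (Fin (2 * 4)) (Fin (2 * 4)) ℝ)) I I')) =
          192 * (∑ I' : Fin 4 → Fin (2 * 4), (k.submatrix S I).det * (k.submatrix S' I').det *
              ((1 : Matrix (Fin (2 * 4)) (Fin (2 * 4)) ℝ).submatrix I I').det) +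
            24 * (∑ I' : Fin 4 → Fin (2 * 4), (k.submatrix S I).det * (k.submatrix S' I').det *
              (wRe⟦4⟧ (1 : Matrix (Fin (2 * 4)) (Fin (2 * 4)) ℝ)) I I') := by
      intro I
      rw [Finset.mul_sum, Finset.mul_sum, ← Finset.sum_add_distrib]
      exact Finset.sum_congr rfl fun I' _ => by ring
    calc ∑ I : Fin 4 → Fin (2 * 4), ∑ I' : Fin 4 → Fin (2 * 4),
          (k.submatrix S I).det * (k.submatrix S' I').det *
            (24 * (8 * ((1 : Matrix (Fin (2 * 4)) (Fin (2 * 4)) ℝ).submatrix I I').det +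
              (wRe⟦4⟧ (1 : Matrix (Fin (2 * 4)) (Fin (2 * 4)) ℝ)) I I'))
        = ∑ I : Fin 4 → Fin (2 * 4),
            (192 * (∑ I' : Fin 4 → Fin (2 * 4), (k.submatrix S I).det * (k.submatrix S' I').det *
                ((1 : Matrix (Fin (2 * 4)) (Fin (2 * 4)) ℝ).submatrix I I').det) +
              24 * (∑ I' : Fin 4 → Fin (2 * 4), (k.submatrix S I).det * (k.submatrix S' I').det *
                (wRe⟦4⟧ (1 : Matrix (Fin (2 * 4)) (Fin (2 * 4)) ℝ)) I I')) :=
          Finset.sum_congr rfl fun I _ => split I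
      _ = 192 * (∑ I : Fin 4 → Fin (2 * 4), ∑ I' : Fin 4 → Fin (2 * 4),
              (k.submatrix S I).det * (k.submatrix S' I').det *
                ((1 : Matrix (Fin (2 * 4)) (Fin (2 * 4)) ℝ).submatrix I I').det) +
            24 * (∑ I : Fin 4 → Fin (2 * 4), ∑ I' : Fin 4 → Fin (2 * 4),
              (k.submatrix S I).det * (k.submatrix S' I').det *
                (wRe⟦4⟧ (1 : Matrix (Fin (2 * 4)) (Fin (2 * 4)) ℝ)) I I') := by
          rw [Finset.sum_add_distrib, Finset.mul_sum, Finset.mul_sum]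
      _ = 576 * (24 * (8 * (Q.submatrix S S').det + (c * (wRe⟦4⟧ Q) S S' + s * (wIm⟦4⟧ Q) S S'))) := by
          rw [hθ, hwr S S']; ring
  have hRHS : ∑ I : Fin 4 → Fin (2 * 4), ∑ I' : Fin 4 → Fin (2 * 4),
      (k.submatrix S I).det * (k.submatrix S' I').det *
        ∑ j, ((w j : ℕ) : ℝ) * (sq⟦(L j).map ((↑) : ℤ → ℝ)⟧ I I') =
      576 * ∑ j, ((w j : ℕ) : ℝ) * (sq⟦k * (L j).map ((↑) : ℤ → ℝ)⟧ S S') := by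
    calc ∑ I : Fin 4 → Fin (2 * 4), ∑ I' : Fin 4 → Fin (2 * 4),
          (k.submatrix S I).det * (k.submatrix S' I').det *
            ∑ j, ((w j : ℕ) : ℝ) * (sq⟦(L j).map ((↑) : ℤ → ℝ)⟧ I I')
        = ∑ I : Fin 4 → Fin (2 * 4), ∑ I' : Fin 4 → Fin (2 * 4), ∑ j,
            ((w j : ℕ) : ℝ) * ((k.submatrix S I).det * (k.submatrix S' I').det *
              (sq⟦(L j).map ((↑) : ℤ → ℝ)⟧ I I')) := by
          refine Finset.sum_congr rfl fun I _ => Finset.sum_congr rfl fun I' _ => ?_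
          rw [Finset.mul_sum]
          exact Finset.sum_congr rfl fun j _ => by ring
      _ = ∑ I : Fin 4 → Fin (2 * 4), ∑ j, ∑ I' : Fin 4 → Fin (2 * 4),
            ((w j : ℕ) : ℝ) * ((k.submatrix S I).det * (k.submatrix S' I').det *
              (sq⟦(L j).map ((↑) : ℤ → ℝ)⟧ I I')) :=
          Finset.sum_congr rfl fun I _ => Finset.sum_comm
      _ = ∑ j, ∑ I : Fin 4 → Fin (2 * 4), ∑ I' : Fin 4 → Fin (2 * 4),
            ((w j : ℕ) : ℝ) * ((k.submatrix S I).det * (k.submatrix S' I').det *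
              (sq⟦(L j).map ((↑) : ℤ → ℝ)⟧ I I')) := Finset.sum_comm
      _ = ∑ j, ((w j : ℕ) : ℝ) * ∑ I : Fin 4 → Fin (2 * 4), ∑ I' : Fin 4 → Fin (2 * 4),
            (k.submatrix S I).det * (k.submatrix S' I').det * (sq⟦(L j).map ((↑) : ℤ → ℝ)⟧ I I') := by
          refine Finset.sum_congr rfl fun j _ => ?_
          rw [Finset.mul_sum]
          refine Finset.sum_congr rfl fun I _ => ?_
          rw [Finset.mul_sum]
      _ = ∑ j, ((w j : ℕ) : ℝ) * ((576 : ℝ) * sq⟦k * (L j).map ((↑) : ℤ → ℝ)⟧ S S') := by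
          refine Finset.sum_congr rfl fun j _ => ?_
          rw [pushforward_frameSquare]
      _ = 576 * ∑ j, ((w j : ℕ) : ℝ) * (sq⟦k * (L j).map ((↑) : ℤ → ℝ)⟧ S S') := by
          rw [Finset.mul_sum]
          exact Finset.sum_congr rfl fun j _ => by ring
  have := key
  rw [hLHS, hRHS] at this
  have h576 : (576 : ℝ) ≠ 0 := by norm_num
  have := mul_left_cancel₀ h576 this
  linarith [this]

/-- **The theta class at every Weil period is a sum of real frame squares:** `24 · θ₄(Q) = Σ_I p_{F_I} ⊗ p_{F_I}` over the
`4`-words `I`, `F_I = (√Q)[I,·]ᵀ` (all-maps Cauchy–Binet for `Q = √Q ᵀ√Q`). [folklore] -/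
theorem thetaClass_eq_sum_realFrameSquares (Q : Matrix (Fin (2 * 4)) (Fin (2 * 4)) ℝ) (hQ : Q.PosDef)
    (hJ : Q * weilJ 4 = weilJ 4 * Q) :
    ∃ F : (Fin 4 → Fin (2 * 4)) → Matrix (Fin (2 * 4)) (Fin 4) ℝ,
      (24 : ℝ) • θ⟦4⟧ Q = ∑ I : Fin 4 → Fin (2 * 4), sq⟦F I⟧ := by
  obtain ⟨h, -, hhQ, -, hT⟩ := exists_sqrt_commuting_weilJ Q hQ hJ
  refine ⟨fun I => hᵀ.submatrix id I, ?_⟩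
  funext S S'
  simp only [Pi.smul_apply, Finset.sum_apply, smul_eq_mul]
  have h24 := det_submatrix_transpose_mul_self_eq_sum h S S'
  rw [hT, hhQ] at h24
  rw [h24]
  refine Finset.sum_congr rfl fun I _ => ?_
  rw [show (hᵀ.submatrix id I).submatrix S id = (h.submatrix I S)ᵀ from by
      ext a b; simp [Matrix.transpose_apply, Matrix.submatrix_apply],
    show (hᵀ.submatrix id I).submatrix S' id = (h.submatrix I S')ᵀ from by
      ext a b; simp [Matrix.transpose_apply, Matrix.submatrix_apply],
    Matrix.det_transpose, Matrix.det_transpose]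

/-! ## §4 The calibration cone lies inside the cone of class positivity, at every Weil period -/

/-- **Class positivity cannot see inside the calibration cone — at ANY Weil period.** Every ℝ-linear functional on the class space that
is `≥ 0` on every square `p_L ⊗ p_L` of the Plücker vector of a SATURATED INTEGER frame (every linear class-level necessary condition for
effectivity of tropical `4`-cycles, `Kappa.nonneg_cyc_of_nonneg_frameSquares`) is `≥ 0` on `q₀ θ₄(Q) + q₁ Re w(Q) + q₂ Im w(Q)` for EVERY
`(q₀, q₁, q₂)` with `q₀ ≥ 0`, `64(q₁² + q₂²) ≤ q₀²` and EVERY positive definite `Q` commuting with `J`. With p332805 (effective classes at a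
Weil-generic `Q` lie in this cone) the picture is closed: on K3's `3`-space the calibration cone is simultaneously an outer bound for
effective classes and an inner bound for what class-level positivity can certify, at the very periods K1 speaks about. K1 (effective classes
on the axis `q₁ = q₂ = 0`) is therefore invisible to every class-level positivity argument; it is a statement about balanced TYPES.
Decides nothing about K1 or HC. [cite: Zharkov2020TropicalWeil, §2] [cite: BlekhermanSmithVelasco2016, Thm. 1.1] -/
theorem nonneg_on_calibrationCone_of_nonneg_frameSquares
    (Φ : ((Fin 4 → Fin (2 * 4)) → (Fin 4 → Fin (2 * 4)) → ℝ) →ₗ[ℝ] ℝ)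
    (hΦ : ∀ L : Matrix (Fin (2 * 4)) (Fin 4) ℤ, (∃ M : Matrix (Fin 4) (Fin (2 * 4)) ℤ, M * L = 1) →
      0 ≤ Φ (fun S S' => ((pluckerCoord L S : ℤ) : ℝ) * ((pluckerCoord L S' : ℤ) : ℝ)))
    (Q : Matrix (Fin (2 * 4)) (Fin (2 * 4)) ℝ) (hQ : Q.PosDef) (hJ : Q * weilJ 4 = weilJ 4 * Q)
    (q0 q1 q2 : ℝ) (hq0 : 0 ≤ q0) (hcone : 64 * (q1 ^ 2 + q2 ^ 2) ≤ q0 ^ 2) :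
    0 ≤ Φ (q0 • θ⟦4⟧ Q + q1 • wRe⟦4⟧ Q + q2 • wIm⟦4⟧ Q) := by
  have hreal : ∀ F : Matrix (Fin (2 * 4)) (Fin 4) ℝ, 0 ≤ Φ (sq⟦F⟧) :=
    fun F => nonneg_realFrameSquare_of_nonneg_frameSquares Φ hΦ F
  -- `Φ(θ₄(Q)) ≥ 0`
  have hθ : 0 ≤ Φ (θ⟦4⟧ Q) := by
    obtain ⟨F, hF⟩ := thetaClass_eq_sum_realFrameSquares Q hQ hJ
    have h24 : (24 : ℝ) * Φ (θ⟦4⟧ Q) = Φ (∑ I : Fin 4 → Fin (2 * 4), sq⟦F I⟧) := by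
      rw [← hF, map_smul, smul_eq_mul]
    have hnn : 0 ≤ Φ (∑ I : Fin 4 → Fin (2 * 4), sq⟦F I⟧) := by
      rw [map_sum]; exact Finset.sum_nonneg fun I _ => hreal _
    rw [← h24] at hnn
    linarith
  -- polar form of `(q1, q2)`
  set r : ℝ := Real.sqrt (q1 ^ 2 + q2 ^ 2) with hr
  have hr0 : 0 ≤ r := Real.sqrt_nonneg _
  have hr2 : r ^ 2 = q1 ^ 2 + q2 ^ 2 := Real.sq_sqrt (by positivity)
  have h8r : 8 * r ≤ q0 := by nlinarith [hr0, hq0, hr2, hcone]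
  by_cases hr00 : r = 0
  · have h1 : q1 = 0 := by nlinarith [sq_nonneg q1, sq_nonneg q2, hr2, hr00]
    have h2 : q2 = 0 := by nlinarith [sq_nonneg q1, sq_nonneg q2, hr2, hr00]
    rw [h1, h2, zero_smul, zero_smul, add_zero, add_zero, map_smul, smul_eq_mul]
    exact mul_nonneg hq0 hθ
  · have hrpos : 0 < r := lt_of_le_of_ne hr0 (Ne.symm hr00)
    set c : ℝ := q1 / r with hc
    set s : ℝ := q2 / r with hs
    have hcs : c ^ 2 + s ^ 2 = 1 := by
      rw [hc, hs, div_pow, div_pow, ← add_div, ← hr2, div_self (pow_ne_zero 2 hr00)]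
    obtain ⟨w, F, -, hid⟩ := cone_boundary_eq_sum_realFrameSquares Q hQ hJ c s hcs
    have hB : 0 ≤ Φ ((8 : ℝ) • θ⟦4⟧ Q + c • wRe⟦4⟧ Q + s • wIm⟦4⟧ Q) := by
      have h24 : (24 : ℝ) * Φ ((8 : ℝ) • θ⟦4⟧ Q + c • wRe⟦4⟧ Q + s • wIm⟦4⟧ Q) =
          Φ (∑ j, ((w j : ℕ) : ℝ) • sq⟦F j⟧) := by rw [← hid, map_smul, smul_eq_mul]
      have hnn : 0 ≤ Φ (∑ j, ((w j : ℕ) : ℝ) • sq⟦F j⟧) := by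
        rw [map_sum]
        refine Finset.sum_nonneg fun j _ => ?_
        rw [map_smul, smul_eq_mul]
        exact mul_nonneg (Nat.cast_nonneg _) (hreal _)
      rw [← h24] at hnn
      linarith
    -- decomposition `q = (q0 - 8r)·(1,0,0) + r·(8,c,s)`
    have hdec : q0 • θ⟦4⟧ Q + q1 • wRe⟦4⟧ Q + q2 • wIm⟦4⟧ Q =
        (q0 - 8 * r) • θ⟦4⟧ Q + r • ((8 : ℝ) • θ⟦4⟧ Q + c • wRe⟦4⟧ Q + s • wIm⟦4⟧ Q) := by
      have hq1 : q1 = r * c := by rw [hc, mul_div_cancel₀ _ hr00]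
      have hq2 : q2 = r * s := by rw [hs, mul_div_cancel₀ _ hr00]
      rw [hq1, hq2]
      funext S S'
      simp only [Pi.add_apply, Pi.smul_apply, smul_eq_mul]
      ring
    rw [hdec, map_add, map_smul, map_smul, smul_eq_mul, smul_eq_mul]
    exact add_nonneg (mul_nonneg (by linarith) hθ) (mul_nonneg hr0 hB)

end Summit.HodgeConjecture.HodgeConjecture.Theorems.TropicalWeilVanishing.Kappa

end
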